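import Mathlib
import Summits.NavierStokesRegularity.NavierStokesRegularity.Theorems.FilamentSkeletonRssSkeletonJ1RLiaLorentzSecondDeriv
import Summits.NavierStokesRegularity.NavierStokesRegularity.Theorems.FilamentSkeletonRssSkeletonJ1RLiaDefectDerivStrands

/-!
# Crux `SkeletonJ1R` (stmt-NavierStokesRegularity-23610) · line `streamline_kantorovich_R` · toward stub F2-d (`LiaDefectDerivBL`, v7), brick of S4′ for B1′:
# THE SECOND PATH-DERIVATIVE OF A LORENTZIAN DATUM-LINE STRAND — `(S′)′ = S″` along a `C²` path (explicit)

Hand `leafhand-ns-filamentskeletonrs-1` (gen 0), `--supports stmt-NavierStokesRegularity-23610 --as helper`.  MODEL rung, NEGATIVE side of the ladder: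
calculus for a HYPOTHETICAL filament-type blow-up skeleton; nothing here is a claim about Navier–Stokes regularity; the stub and the crux stay OPEN.

`hasDerivAt_lorentzStrandDeriv_comp` — companion of `…LiaDefectDerivStrands.hasDerivAt_lorentzStrand_comp`: along a path `y` with `y′ = deriv y` and
`HasDerivAt (deriv y) y″ τ`, the first derivative `S′(p) = (−2q′/q²)•t×(y p − w) + (2/q)•t×y′(p)` of the Lorentzian strand has derivative
`S″ = (−2q″/q² + 4q′²/q³)•t×(yτ − w) − (4q′/q²)•t×y′τ + (2/q)•t×y″` at `τ`
(`q = ‖y−w‖² − ⟪y−w,t⟫² + a`, `q′ = 2⟪y−w,y′⟫ − 2⟪y−w,t⟫⟪y′,t⟫`, `q″ = 2⟪y′,y′⟫ + 2⟪y−w,y″⟫ − 2⟪y′,t⟫² − 2⟪y−w,t⟫⟪y″,t⟫`) — exactly the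
expression bounded by `…LiaLorentzSecondDeriv.norm_lorentzStrand_deriv_two_le` (`≤ 28/d³ + 6κ/d²`).  Mean value then gives the Lipschitz constant of
`(W∘x)′` on the window, the `D²W` part of `H′` in S4′.
-/

set_option linter.dupNamespace false -- `NavierStokesRegularity.NavierStokesRegularity` path/namespace repetition is the tree convention

noncomputable section

namespace Summit.NavierStokesRegularity.NavierStokesRegularity.Theorems.SkeletonJ1RFrame

open Set Function Filter MeasureTheory Real Topology
open Literature.Analysis.FluidPDE
open scoped InnerProductSpace BigOperators

/-- **`(S′)′ = S″` along a path** (module docstring). [folklore] -/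
theorem hasDerivAt_lorentzStrandDeriv_comp {a : ℝ} (ha : 0 < a) (w t : EuclideanSpace ℝ (Fin 3)) (ht : ‖t‖ = 1)
    {y : ℝ → EuclideanSpace ℝ (Fin 3)} {y'' : EuclideanSpace ℝ (Fin 3)} {τ : ℝ} (hy : HasDerivAt y (deriv y τ) τ)
    (hy2 : HasDerivAt (deriv y) y'' τ) :
    HasDerivAt (fun p => (-(2 * (2 * ⟪y p - w, deriv y p⟫_ℝ - 2 * ⟪y p - w, t⟫_ℝ * ⟪deriv y p, t⟫_ℝ)) /
            (‖y p - w‖ ^ 2 - ⟪y p - w, t⟫_ℝ ^ 2 + a) ^ 2) • cross t (y p - w) +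
        (2 / (‖y p - w‖ ^ 2 - ⟪y p - w, t⟫_ℝ ^ 2 + a)) • cross t (deriv y p))
      ((-(2 * (2 * ⟪deriv y τ, deriv y τ⟫_ℝ + 2 * ⟪y τ - w, y''⟫_ℝ - 2 * ⟪deriv y τ, t⟫_ℝ ^ 2 - 2 * ⟪y τ - w, t⟫_ℝ * ⟪y'', t⟫_ℝ)) /
              (‖y τ - w‖ ^ 2 - ⟪y τ - w, t⟫_ℝ ^ 2 + a) ^ 2 +
            4 * (2 * ⟪y τ - w, deriv y τ⟫_ℝ - 2 * ⟪y τ - w, t⟫_ℝ * ⟪deriv y τ, t⟫_ℝ) ^ 2 / (‖y τ - w‖ ^ 2 - ⟪y τ - w, t⟫_ℝ ^ 2 + a) ^ 3) •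
            cross t (y τ - w) -
          (4 * (2 * ⟪y τ - w, deriv y τ⟫_ℝ - 2 * ⟪y τ - w, t⟫_ℝ * ⟪deriv y τ, t⟫_ℝ) / (‖y τ - w‖ ^ 2 - ⟪y τ - w, t⟫_ℝ ^ 2 + a) ^ 2) •
            cross t (deriv y τ) +
        (2 / (‖y τ - w‖ ^ 2 - ⟪y τ - w, t⟫_ℝ ^ 2 + a)) • cross t y'') τ := by
  -- abbreviations at τ
  set v := y τ - w with hv
  set D := deriv y τ with hD
  set q : ℝ := ‖v‖ ^ 2 - ⟪v, t⟫_ℝ ^ 2 + a with hq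
  set q1 : ℝ := 2 * ⟪v, D⟫_ℝ - 2 * ⟪v, t⟫_ℝ * ⟪D, t⟫_ℝ with hq1
  set q2 : ℝ := 2 * ⟪D, D⟫_ℝ + 2 * ⟪v, y''⟫_ℝ - 2 * ⟪D, t⟫_ℝ ^ 2 - 2 * ⟪v, t⟫_ℝ * ⟪y'', t⟫_ℝ with hq2
  have hqpos : 0 < q := lorentzStrand_pos ha t v ht
  -- the path pieces
  have hvd : HasDerivAt (fun p => y p - w) D τ := hy.sub_const w
  -- q and its derivative q1
  have hQ : HasDerivAt (fun p => ‖y p - w‖ ^ 2 - ⟪y p - w, t⟫_ℝ ^ 2 + a) q1 τ := by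
    have h1 : HasDerivAt (fun p => ‖y p - w‖ ^ 2) (2 * ⟪v, D⟫_ℝ) τ := hvd.norm_sq
    have h2 : HasDerivAt (fun p => ⟪y p - w, t⟫_ℝ) ⟪D, t⟫_ℝ τ := by
      have h := hvd.inner ℝ (hasDerivAt_const τ t); simpa using h
    have h3 : HasDerivAt (fun p => ⟪y p - w, t⟫_ℝ ^ 2) (2 * ⟪v, t⟫_ℝ * ⟪D, t⟫_ℝ) τ := by
      have h := h2.mul h2
      refine (h.congr_of_eventuallyEq (Eventually.of_forall fun s => ?_)).congr_deriv (by rw [hv]; ring)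
      simp only [Pi.mul_apply, pow_two]
    exact ((h1.sub h3).add_const a).congr_deriv (by rw [hq1])
  -- q1 as a function and its derivative q2
  have hQ1 : HasDerivAt (fun p => 2 * ⟪y p - w, deriv y p⟫_ℝ - 2 * ⟪y p - w, t⟫_ℝ * ⟪deriv y p, t⟫_ℝ) q2 τ := by
    have h1 : HasDerivAt (fun p => ⟪y p - w, deriv y p⟫_ℝ) (⟪v, y''⟫_ℝ + ⟪D, D⟫_ℝ) τ := by
      have h := hvd.inner ℝ hy2
      simpa [hv, hD, real_inner_comm] using h
    have h2 : HasDerivAt (fun p => ⟪y p - w, t⟫_ℝ) ⟪D, t⟫_ℝ τ := by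
      have h := hvd.inner ℝ (hasDerivAt_const τ t); simpa using h
    have h3 : HasDerivAt (fun p => ⟪deriv y p, t⟫_ℝ) ⟪y'', t⟫_ℝ τ := by
      have h := hy2.inner ℝ (hasDerivAt_const τ t); simpa using h
    have h4 := h2.mul h3
    have h := (h1.const_mul 2).sub (h4.const_mul 2)
    refine (h.congr_of_eventuallyEq (Eventually.of_forall fun s => ?_)).congr_deriv ?_
    · simp only [Pi.sub_apply, Pi.mul_apply]; ring
    · rw [hq2, hv, hD]; ring
  -- the scalar coefficients
  have hc1 : HasDerivAt (fun p => -(2 * (2 * ⟪y p - w, deriv y p⟫_ℝ - 2 * ⟪y p - w, t⟫_ℝ * ⟪deriv y p, t⟫_ℝ)) /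
        (‖y p - w‖ ^ 2 - ⟪y p - w, t⟫_ℝ ^ 2 + a) ^ 2) (-(2 * q2) / q ^ 2 + 4 * q1 ^ 2 / q ^ 3) τ := by
    have hnum : HasDerivAt (fun p => -(2 * (2 * ⟪y p - w, deriv y p⟫_ℝ - 2 * ⟪y p - w, t⟫_ℝ * ⟪deriv y p, t⟫_ℝ))) (-(2 * q2)) τ :=
      (hQ1.const_mul 2).neg
    have hden : HasDerivAt (fun p => (‖y p - w‖ ^ 2 - ⟪y p - w, t⟫_ℝ ^ 2 + a) ^ 2) (2 * q * q1) τ := by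
      have h := hQ.mul hQ
      refine (h.congr_of_eventuallyEq (Eventually.of_forall fun s => ?_)).congr_deriv ?_
      · simp only [Pi.mul_apply, pow_two]
      · simp only [← hv, ← hq]; ring
    have h := hnum.div hden (by positivity : q ^ 2 ≠ 0)
    refine h.congr_deriv ?_
    simp only [← hv, ← hD, ← hq, ← hq1]
    field_simp
    ring
  have hc2 : HasDerivAt (fun p => 2 / (‖y p - w‖ ^ 2 - ⟪y p - w, t⟫_ℝ ^ 2 + a)) (-(2 * q1) / q ^ 2) τ := by
    have h := (hasDerivAt_const τ (2:ℝ)).div hQ hqpos.ne'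
    refine h.congr_deriv ?_
    ring
  -- the vector factors
  have hX1 : HasDerivAt (fun p => cross t (y p - w)) (cross t D) τ := (crossCLM t).hasFDerivAt.comp_hasDerivAt τ hvd
  have hX2 : HasDerivAt (fun p => cross t (deriv y p)) (cross t y'') τ := (crossCLM t).hasFDerivAt.comp_hasDerivAt τ hy2
  have h := (hc1.smul hX1).add (hc2.smul hX2)
  refine h.congr_deriv ?_
  simp only [← hv, ← hD, ← hq, ← hq1]
  module

end Summit.NavierStokesRegularity.NavierStokesRegularity.Theorems.SkeletonJ1RFrame

end
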